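import Mathlib.LinearAlgebra.FiniteDimensional.Lemmas
import Mathlib.LinearAlgebra.Dimension.Finrank
import HarnessLib

/-!
# Meyer's global difference representation — proofs: a common kernel vector for a commuting
# family of endomorphisms that are nilpotent on an invariant finite-dimensional subspace

Topic `NumberTheory/Automorphic`; namespace `Literature.NumberTheory.Automorphic.Meyer`. Sibling
PROOF file (linear algebra, Mathlib only) for Step E (upper bound) of the plan for
`Meyer.spectralRealisation_rat` [Meyer2005, Thm. 5.11]: inside a finite-dimensional `π₋`-invariant
subspace of the joint generalised eigenspace of a character `χ` of the abelian group `C_ℚ`, the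
operators `π₋(g) - χ(g)` form a commuting family, each nilpotent on the subspace; such a family
has a common kernel vector, i.e. a JOINT EIGENVECTOR of `π₋` — the reduction used to read the
spectral multiplicity of [Meyer2005, §2.3] off eigenvectors.

* `exists_common_kernel_vector` — for a commuting family `T : ι → End V`, an invariant
  finite-dimensional `U ≠ ⊥` on which every `T i` is locally nilpotent, there is `0 ≠ u ∈ U` with
  `T i u = 0` for all `i`.

Everything is proved; no definitions.

## References

* R. Meyer, *On a representation of the idele class group related to primes and zeros of
  L-functions*, Duke Math. J. 127 (2005) = arXiv:math/0311468, §2.3 [Meyer2005].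
-/

namespace Literature.NumberTheory.Automorphic.Meyer

variable {K V : Type*} [Field K] [AddCommGroup V] [Module K V] {ι : Type*}

/-- A locally nilpotent endomorphism of an invariant subspace `U ≠ ⊥` kills a non-zero vector of `U`.
[folklore] -/
theorem exists_mem_ker_of_locally_nilpotent (T : Module.End K V) (U : Submodule K V)
    (hinv : U ≤ U.comap T) (hnil : ∀ u ∈ U, ∃ n : ℕ, (T ^ n) u = 0) (hU : U ≠ ⊥) :
    ∃ w ∈ U, w ≠ 0 ∧ T w = 0 := by
  classical
  obtain ⟨u, huU, hu0⟩ := Submodule.exists_mem_ne_zero_of_ne_bot hU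
  obtain ⟨n, hn⟩ := hnil u huU
  -- the least `n` with `T^n u = 0` is positive; `w = T^{n-1} u`
  have hex : ∃ n : ℕ, (T ^ n) u = 0 := ⟨n, hn⟩
  set m := Nat.find hex with hmdef
  have hm : (T ^ m) u = 0 := Nat.find_spec hex
  have hm0 : m ≠ 0 := by
    intro h0
    rw [h0, pow_zero, Module.End.one_apply] at hm
    exact hu0 hm
  obtain ⟨k, hk⟩ := Nat.exists_eq_succ_of_ne_zero hm0
  have hkm : k < m := by rw [hk]; exact Nat.lt_succ_self k
  have hkmin : (T ^ k) u ≠ 0 := Nat.find_min hex (by rwa [hmdef] at hkm)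
  have hpow_mem : ∀ j : ℕ, (T ^ j) u ∈ U := by
    intro j
    induction j with
    | zero => simpa using huU
    | succ j ih =>
        rw [pow_succ', Module.End.mul_apply]
        exact hinv ih
  refine ⟨(T ^ k) u, hpow_mem k, hkmin, ?_⟩
  rw [← Module.End.mul_apply, ← pow_succ']
  rw [hk] at hm
  exact hm

/-- **A commuting family of endomorphisms, locally nilpotent on an invariant finite-dimensional
subspace `U ≠ ⊥`, has a common kernel vector in `U`.** [folklore] -/
theorem exists_common_kernel_vector (T : ι → Module.End K V) (hcomm : ∀ i j, Commute (T i) (T j)) :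
    ∀ (U : Submodule K V), FiniteDimensional K U → (∀ i, U ≤ U.comap (T i)) →
      (∀ i, ∀ u ∈ U, ∃ n : ℕ, (T i ^ n) u = 0) → U ≠ ⊥ → ∃ u ∈ U, u ≠ 0 ∧ ∀ i, T i u = 0 := by
  -- strong induction on the dimension of `U`
  suffices h : ∀ (d : ℕ) (U : Submodule K V), FiniteDimensional K U → Module.finrank K U = d →
      (∀ i, U ≤ U.comap (T i)) → (∀ i, ∀ u ∈ U, ∃ n : ℕ, (T i ^ n) u = 0) → U ≠ ⊥ →
        ∃ u ∈ U, u ≠ 0 ∧ ∀ i, T i u = 0 from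
    fun U hfin hinv hnil hU => h _ U hfin rfl hinv hnil hU
  intro d
  induction d using Nat.strong_induction_on with
  | _ d ih =>
    intro U hfin hd hinv hnil hU
    haveI := hfin
    by_cases hall : ∀ i, ∀ u ∈ U, T i u = 0
    · obtain ⟨u, huU, hu0⟩ := Submodule.exists_mem_ne_zero_of_ne_bot hU
      exact ⟨u, huU, hu0, fun i => hall i u huU⟩
    · simp only [not_forall] at hall
      obtain ⟨i₀, u₀, hu₀U, hu₀⟩ := hall
      -- `W = U ⊓ ker (T i₀)`, a non-zero invariant subspace of smaller dimension
      set W : Submodule K V := U ⊓ LinearMap.ker (T i₀) with hW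
      have hWU : W ≤ U := inf_le_left
      have hWne : W ≠ ⊥ := by
        obtain ⟨w, hwU, hw0, hTw⟩ := exists_mem_ker_of_locally_nilpotent (T i₀) U (hinv i₀) (hnil i₀) hU
        intro hbot
        have : w ∈ W := ⟨hwU, LinearMap.mem_ker.mpr hTw⟩
        rw [hbot, Submodule.mem_bot] at this
        exact hw0 this
      have hWlt : W < U := by
        refine lt_of_le_of_ne hWU fun heq => hu₀ ?_
        have : u₀ ∈ W := by rw [heq]; exact hu₀U
        exact LinearMap.mem_ker.mp this.2
      have hWinv : ∀ i, W ≤ W.comap (T i) := by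
        intro i w hw
        refine ⟨hinv i hw.1, ?_⟩
        change T i w ∈ LinearMap.ker (T i₀)
        rw [LinearMap.mem_ker]
        have h1 : T i₀ (T i w) = T i (T i₀ w) := by
          rw [← Module.End.mul_apply, (hcomm i₀ i).eq, Module.End.mul_apply]
        rw [h1, LinearMap.mem_ker.mp hw.2, map_zero]
      have hWnil : ∀ i, ∀ w ∈ W, ∃ n : ℕ, (T i ^ n) w = 0 := fun i w hw => hnil i w hw.1
      haveI : FiniteDimensional K W := Submodule.finiteDimensional_of_le hWU
      have hdim : Module.finrank K W < d := by rw [← hd]; exact Submodule.finrank_lt_finrank_of_lt hWlt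
      obtain ⟨u, huW, hu0, hTu⟩ := ih _ hdim W inferInstance rfl hWinv hWnil hWne
      exact ⟨u, hWU huW, hu0, hTu⟩

end Literature.NumberTheory.Automorphic.Meyer
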